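/-
Copyright (c) 2026 the pub-hodgecm-mathlib formalisation cell (harness21).  Prover seat hodgecm-mathlib-K2E1-p09 (g4), Track B ∕ K2-LIT,
h413 = `stmt-HodgeConjecture-24833`, line `K2_E1_TraceFormulaBeta`, campaign RES-RANK-ONE, page «EIS-RANK-ONE»: DEAL «EIS-R5a INTERTWINING» of the dealer
K2E1-plan (g3) 2026-09-04T04:27:29Z — the rank-one intertwining operator `M(w₀)`.
-/
import Summits.HodgeConjecture.HodgeConjecture.Theorems.K2E1EisensteinConstantTermU        -- ★ p857329 ∕ p857309 (this seat): «`E_B(φ) = φ + M(w₀)φ`», transport, Mok instances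
import Literature.NumberTheory.Automorphic.UnitaryGroupBorelModulusTwo                   -- ★ `map_torusConj_eq_torusRootModulus_smul_two` (`δ_B` on the torus of `U(J₂)`)
import Literature.NumberTheory.Automorphic.UnitaryGroupUnipotentHaarTorusConj            -- ★ `map_torusConj_eq_torusRootModulus_smul` (`U(J₃)`)
import HarnessLib

/-!
# h413 ∕ Track B «K2-LIT», page EIS-RANK-ONE — `K2E1EisensteinIntertwiningU`: the rank-one INTERTWINING OPERATOR `M(w₀)φ (x) = ∫_{N(𝔸)} φ(x v w₀⁻¹) dν(v)`
# (definition), its `N(𝔸)`-invariance, its TORUS EQUIVARIANCE WITH THE MODULUS (hypothesis-style), and «`E_B(φ) = φ + M(w₀)φ`» restated through it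

Cell `pub/hodgecm-mathlib`, crux H413 = `stmt-HodgeConjecture-24833`, route `HCCMUnconditional`; chair K2-lead (g0), dealer K2E1-plan (g3) (ruling R-EIS-1).  ONE
DEFINITION WITH BODY (`intertwiningU`, generic — Mok's `U(J_N)` is an application, no second def) + THEOREMS; no `instance`, no `notation`, no named-fact hypothesis,
no `sorry`; lane `--kind definition --supports stmt-HodgeConjecture-24833 --as helper` (count-neutral).

In the tree's RIGHT-coset convention (★ p857309: `E_φ(g) = Σ'_{q ∈ Γ⧸B_Γ} φ(g q̃)`, `φ = φ_s ∘ inv` for a section `φ_s` of `Ind_B`), the big-cell term of the constant term is the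
**intertwining operator** `intertwiningU N ν w₀ φ x := ∫_{N} φ(x v w₀⁻¹) dν(v)` [MW1995 II.1.6 `M(w, π)`; Garrett2018 §2.8]:
* §1 `intertwiningU` (def) and «`E_B(φ) = φ + M(w₀)φ`» through it: `setLIntegral`-free restatements `setIntegral_tsum_borelQuotient_eq_intertwiningU` (generic, = ★
  p857309 by `rfl`) and `…_quasiSplit_two ∕ _three` (= ★ p857329);
* §2 **`intertwiningU_mul_coe`** — `M(w₀)φ (x n) = M(w₀)φ (x)` for `n ∈ N(𝔸)` and ANY `φ` (left invariance of `ν` alone);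
* §3 **`intertwiningU_mul_eq_mul`** — TORUS EQUIVARIANCE, hypothesis-style and convention-agnostic: if `t` normalises `N` with `(v ↦ t v t⁻¹)_* ν = C • ν` and
  `φ(y · w₀ t w₀⁻¹) = ξ · φ(y)` for all `y`, then `M(w₀)φ (x t) = C.toReal · ξ · M(w₀)φ (x)` (`x t v w₀⁻¹ = x (t v t⁻¹) w₀⁻¹ (w₀ t w₀⁻¹)`); on `U(J₂)`, `U(J₃)`:
  **`intertwiningU_mul_torus_quasiSplit_two ∕ _three`** with `C = δ_B(t⁻¹) = torusRootModulus E N d⁻¹` for `t = diag(d) ∈ T(𝔸_F)` (★ `map_torusConj_eq_torusRootModulus_smul(_two)`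
  at `t⁻¹`), `ξ` kept as the hypothesis on `φ` (the exponent flip «`z ↦ 2ρ_H − z`, `χ ↦ w₀χ`» in `borelHeight` ∕ `flatSectionU` currency is ONE corollary once ★
  `K2E1BorelEisensteinUDefs` (K2E1-p08 (g4)) lands — deliberately not typed against an unlanded def);
* §4 **ABSOLUTE CONVERGENCE FOR FREE**: `integrable_intertwiningU_integrand_quasiSplit_two ∕ _three` — `∫⁻_{u∈𝓕} E_{‖φ‖}(x u⁻¹) dν < ∞ → Integrable (v ↦ φ(x v ι(J_N)⁻¹)) ν` (★ p857309
  `integrable_translate_weyl` through ★ p857329 `bruhat_quotientSubgroup_of_rational`; the finiteness is what Godement's majorant delivers — cf. the K2Liu twin ★ `K2LiuIntertwiningConverges`).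
NOT HERE: continuity of `x ↦ M(w₀)φ(x)` (dominated convergence; sequel), the LEFT-convention bridge `K2E1EisensteinSeriesLeftRight` (queued after ★ `K2E1BorelEisensteinUDefs`).

HONEST LABEL.  Count-neutral helper; proves no printed statement; HC_CM is proved only modulo the 7 printed citations (2 remaining named inputs: hLiu418 =
`stmt-HodgeConjecture-24832`, h413 = `stmt-HodgeConjecture-24833`) until rung 0 closes.

## References
* [MoeglinWaldspurger1995] C. Mœglin, J.-L. Waldspurger, *Spectral decomposition and Eisenstein series* (1995), II.1.6–II.1.7.
* [Garrett2018] P. Garrett, *Modern Analysis of Automorphic Forms by Example* 1 (2018), §2.8 (PDF p. 114: `∫_{N_𝔸} f(w n m g) dn = ν(m)^{1−s} χ(w m w⁻¹) ∫ f(w n g) dn`).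
* [Rogawski1990] J. D. Rogawski, *Automorphic Representations of Unitary Groups in Three Variables* (1990), §2.2 (`δ_B(d(a,b,ā⁻¹)) = ‖a‖²`).
-/

set_option autoImplicit false
set_option linter.dupNamespace false  -- the mandated namespace repeats the summit's segment (`HodgeConjecture.HodgeConjecture`)

noncomputable section
open MeasureTheory Measure Set Filter Topology NumberField IsDedekindDomain Matrix
open Literature.NumberTheory.Automorphic Literature.NumberTheory.Automorphic.UnitaryGroup AdelicGroupData
open Summit.HodgeConjecture.HodgeConjecture.Cruxes.H413.K2E1EisensteinConstantTerm
open Summit.HodgeConjecture.HodgeConjecture.Cruxes.H413.K2E1EisensteinConstantTermU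
open scoped ENNReal NNReal Pointwise MatrixGroups

namespace Summit.HodgeConjecture.HodgeConjecture.Cruxes.H413.K2E1EisensteinIntertwiningU

/-! ## §1 The intertwining operator and «`E_B(φ) = φ + M(w₀)φ`» through it -/

section Generic

variable {G : Type*} [Group G] [MeasurableSpace G] (N : Subgroup G) (ν : Measure N)

/-- **The rank-one intertwining operator** `M(w₀)φ (x) = ∫_N φ(x v w₀⁻¹) dν(v)` in the tree's right-coset convention (`φ = φ_s ∘ inv` for a section of `Ind_B`; Bochner
integral, junk value `0` off the domain of integrability) — the big-cell term of the constant term of the Eisenstein-type sum `E_φ = Σ_{Γ⧸B_Γ} φ` (★ p857309).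
[cite: MoeglinWaldspurger1995, II.1.6] [cite: Garrett2018, §2.8] -/
def intertwiningU (w : G) (φ : G → ℂ) (x : G) : ℂ := ∫ v : N, φ (x * (v : G) * w⁻¹) ∂ν

/-- Unfolding `intertwiningU`. [cite: MoeglinWaldspurger1995, II.1.6] -/
theorem intertwiningU_apply (w : G) (φ : G → ℂ) (x : G) : intertwiningU N ν w φ x = ∫ v : N, φ (x * (v : G) * w⁻¹) ∂ν := rfl

variable [TopologicalSpace G] [IsTopologicalGroup G] [BorelSpace G] [SecondCountableTopology G] (Γ : Subgroup G) [DiscreteTopology Γ]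

/-- **«`E_B(φ) = φ + M(w₀)φ`» THROUGH THE DEFINITION** (★ p857309 `setIntegral_tsum_borelQuotient_eq` verbatim, the big cell renamed): under `∫⁻_𝓕 E_{‖φ‖}(x u⁻¹) dν < ∞`,
`∫_{u∈𝓕} E_φ(x u⁻¹) dν = (ν 𝓕).toReal • φ(x) + intertwiningU N ν w₀ φ x`. [cite: MoeglinWaldspurger1995, II.1.7] -/
theorem setIntegral_tsum_borelQuotient_eq_intertwiningU [ν.IsMulLeftInvariant] [ν.IsInvInvariant] {φ : G → ℂ} (hφm : Measurable φ)
    (hφN : ∀ (g : G) (n : N), φ (g * n) = φ g) {B : Subgroup Γ} (hφB : ∀ (g : G) (b : Γ), b ∈ B → φ (g * (b : G)) = φ g) {w : Γ}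
    (e : Option ↥(N.subgroupOf Γ) ≃ Γ ⧸ B) (he₁ : e none = ((1 : Γ) : Γ ⧸ B)) (he₂ : ∀ n : N.subgroupOf Γ, e (some n) = (((n : Γ) * w⁻¹ : Γ) : Γ ⧸ B))
    {𝓕 : Set N} (h𝓕 : IsFundamentalDomain (Γ.subgroupOf N) 𝓕 ν) (x : G)
    (hfin : ∫⁻ u in 𝓕, (∑' q : Γ ⧸ B, ‖φ (x * (u : G)⁻¹ * (q.out : G))‖ₑ) ∂ν < ∞) :
    ∫ u in 𝓕, (∑' q : Γ ⧸ B, φ (x * (u : G)⁻¹ * (q.out : G))) ∂ν = (ν 𝓕).toReal • φ x + intertwiningU N ν (w : G) φ x :=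
  setIntegral_tsum_borelQuotient_eq Γ N ν hφm hφN hφB e he₁ he₂ h𝓕 x hfin

end Generic

/-! ## §2 `N(𝔸)`-invariance -/

section Invariance

variable {G : Type*} [Group G] [TopologicalSpace G] [IsTopologicalGroup G] [MeasurableSpace G] [BorelSpace G] (N : Subgroup G)
  (ν : Measure N) [ν.IsMulLeftInvariant]

/-- **`M(w₀)φ (x n) = M(w₀)φ (x)` for `n ∈ N`**, for ANY `φ`: `∫ φ(x n v w₀⁻¹) dν(v) = ∫ φ(x v w₀⁻¹) dν(v)` by left invariance of `ν` (`v ↦ n⁻¹ v`).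
[cite: MoeglinWaldspurger1995, II.1.6] -/
theorem intertwiningU_mul_coe (w : G) (φ : G → ℂ) (x : G) (n : N) :
    intertwiningU N ν w φ (x * (n : G)) = intertwiningU N ν w φ x := by
  unfold intertwiningU
  have h : (fun v : N => φ (x * (n : G) * (v : G) * w⁻¹)) = fun v : N => (fun u : N => φ (x * (u : G) * w⁻¹)) (n * v) := by
    funext v; simp only [Subgroup.coe_mul, mul_assoc]
  rw [h]
  exact integral_mul_left_eq_self (fun u : N => φ (x * (u : G) * w⁻¹)) n

end Invariance

/-! ## §3 Torus equivariance with the modulus (hypothesis-style) -/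

section Equivariance

variable {G : Type*} [Group G] [TopologicalSpace G] [IsTopologicalGroup G] [MeasurableSpace G] [BorelSpace G] [SecondCountableTopology G]
  (N : Subgroup G) (ν : Measure N)

/-- **TORUS EQUIVARIANCE OF `M(w₀)`, WITH THE MODULUS** (generic, convention-agnostic): let `t ∈ G` normalise `N` with `(v ↦ t v t⁻¹)_* ν = C • ν` and let `φ` satisfy
`φ(y · w₀ t w₀⁻¹) = ξ · φ(y)` for all `y`.  Then `M(w₀)φ (x t) = C.toReal · ξ · M(w₀)φ (x)` — because `x t v w₀⁻¹ = x (t v t⁻¹) w₀⁻¹ · (w₀ t w₀⁻¹)`.  In print: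
`∫_N f(w n m g) dn = δ(m)^{…} χ(w m w⁻¹) ∫_N f(w n g) dn`. [cite: Garrett2018, §2.8] [cite: MoeglinWaldspurger1995, II.1.6] -/
theorem intertwiningU_mul_eq_mul {w : G} {φ : G → ℂ} (hφm : Measurable φ) {t : G} (htN : ∀ v : N, t * (v : G) * t⁻¹ ∈ N) {C : ℝ≥0∞}
    (hmod : ν.map (fun v : N => (⟨t * (v : G) * t⁻¹, htN v⟩ : N)) = C • ν) {ξ : ℂ} (hφt : ∀ y : G, φ (y * (w * t * w⁻¹)) = ξ * φ y) (x : G) :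
    intertwiningU N ν w φ (x * t) = (C.toReal : ℂ) * ξ * intertwiningU N ν w φ x := by
  unfold intertwiningU
  have hκ : Measurable fun v : N => (⟨t * (v : G) * t⁻¹, htN v⟩ : N) := ((measurable_const.mul measurable_subtype_coe).mul measurable_const).subtype_mk
  have hg : Measurable fun u : N => φ (x * (u : G) * w⁻¹ * (w * t * w⁻¹)) := hφm.comp (((measurable_const.mul measurable_subtype_coe).mul measurable_const).mul measurable_const)
  have h1 : (fun v : N => φ (x * t * (v : G) * w⁻¹)) = fun v : N => (fun u : N => φ (x * (u : G) * w⁻¹ * (w * t * w⁻¹))) (⟨t * (v : G) * t⁻¹, htN v⟩ : N) := by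
    funext v
    change φ (x * t * (v : G) * w⁻¹) = φ (x * (t * (v : G) * t⁻¹) * w⁻¹ * (w * t * w⁻¹))
    congr 1; group
  rw [h1, ← integral_map hκ.aemeasurable hg.aestronglyMeasurable, hmod, integral_smul_measure]
  simp_rw [hφt]
  rw [integral_const_mul, Complex.real_smul, mul_assoc]

end Equivariance

/-! ## §4 Mok's `U(J₂)`, `U(J₃)`: «`E_B = φ + M(w₀)φ`» through the definition, absolute convergence for free, torus equivariance with `δ_B` -/

section Mok

variable {F E : Type} [Field F] [NumberField F] [Field E] [NumberField E] [Algebra F E] {c : E ≃ₐ[F] E}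

/-- **«`E_B(φ) = φ + M(w₀)φ`» ON `U(J₂)(𝔸_F)` THROUGH `intertwiningU`** (★ p857329 `…_quasiSplit_two` verbatim, `w₀ = ι(J₂)`): under `∫⁻_𝓕 E_{‖φ‖} < ∞`,
`∫_{u∈𝓕} E_φ(x u⁻¹) dν = (ν 𝓕).toReal • φ(x) + intertwiningU N(𝔸) ν ι(J₂) φ x`. [cite: MoeglinWaldspurger1995, II.1.7] -/
theorem setIntegral_tsum_borelQuotient_eq_intertwiningU_quasiSplit_two [MeasurableSpace (quasiSplit F E c 2).Adelic] [BorelSpace (quasiSplit F E c 2).Adelic]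
    (νN : Measure ↥(adelicUnipotent F E c 2)) [νN.IsMulLeftInvariant] [νN.IsInvInvariant]
    {φ : (quasiSplit F E c 2).Adelic → ℂ} (hφm : Measurable φ) (hφN : ∀ (g : (quasiSplit F E c 2).Adelic) (n : ↥(adelicUnipotent F E c 2)), φ (g * n) = φ g)
    (hφB : ∀ (g : (quasiSplit F E c 2).Adelic) (b : (quasiSplit F E c 2).quotientSubgroup),
      b ∈ (borelAdelic F E c 2).subgroupOf (quasiSplit F E c 2).quotientSubgroup → φ (g * (b : (quasiSplit F E c 2).Adelic)) = φ g)
    {𝓕 : Set ↥(adelicUnipotent F E c 2)} (h𝓕 : IsFundamentalDomain ↥(rationalUnipotent F E c 2) 𝓕 νN) (x : (quasiSplit F E c 2).Adelic)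
    (hfin : ∫⁻ u in 𝓕, (∑' q : (quasiSplit F E c 2).quotientSubgroup ⧸ (borelAdelic F E c 2).subgroupOf (quasiSplit F E c 2).quotientSubgroup,
        ‖φ (x * (u : (quasiSplit F E c 2).Adelic)⁻¹ * ((q.out : (quasiSplit F E c 2).quotientSubgroup) : (quasiSplit F E c 2).Adelic))‖ₑ) ∂νN < ∞) :
    ∫ u in 𝓕, (∑' q : (quasiSplit F E c 2).quotientSubgroup ⧸ (borelAdelic F E c 2).subgroupOf (quasiSplit F E c 2).quotientSubgroup,
        φ (x * (u : (quasiSplit F E c 2).Adelic)⁻¹ * ((q.out : (quasiSplit F E c 2).quotientSubgroup) : (quasiSplit F E c 2).Adelic))) ∂νN =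
      (νN 𝓕).toReal • φ x + intertwiningU (adelicUnipotent F E c 2) νN
        ((quasiSplit F E c 2).toAdelic (weylLongU (c : E →+* E) (rfl : (StdForm.antidiagonal 2).over E = (StdForm.antidiagonal 2).over E))) φ x :=
  setIntegral_tsum_borelQuotient_eq_quasiSplit_two νN hφm hφN hφB h𝓕 x hfin

/-- **ABSOLUTE CONVERGENCE OF `M(w₀)φ` ON `U(J₂)` FOR FREE**: `∫⁻_{u∈𝓕} E_{‖φ‖}(x u⁻¹) dν < ∞` (what Godement's majorant delivers) makes `v ↦ φ(x v ι(J₂)⁻¹)` integrable on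
`N(𝔸_F)` (★ `integrable_translate_weyl` through ★ `bruhat_quotientSubgroup_of_rational`). [cite: MoeglinWaldspurger1995, II.1.6] -/
theorem integrable_intertwiningU_integrand_quasiSplit_two [MeasurableSpace (quasiSplit F E c 2).Adelic] [BorelSpace (quasiSplit F E c 2).Adelic]
    (νN : Measure ↥(adelicUnipotent F E c 2)) [νN.IsMulLeftInvariant] [νN.IsInvInvariant]
    {φ : (quasiSplit F E c 2).Adelic → ℂ} (hφm : Measurable φ) (hφN : ∀ (g : (quasiSplit F E c 2).Adelic) (n : ↥(adelicUnipotent F E c 2)), φ (g * n) = φ g)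
    (hφB : ∀ (g : (quasiSplit F E c 2).Adelic) (b : (quasiSplit F E c 2).quotientSubgroup),
      b ∈ (borelAdelic F E c 2).subgroupOf (quasiSplit F E c 2).quotientSubgroup → φ (g * (b : (quasiSplit F E c 2).Adelic)) = φ g)
    {𝓕 : Set ↥(adelicUnipotent F E c 2)} (h𝓕 : IsFundamentalDomain ↥(rationalUnipotent F E c 2) 𝓕 νN) (x : (quasiSplit F E c 2).Adelic)
    (hfin : ∫⁻ u in 𝓕, (∑' q : (quasiSplit F E c 2).quotientSubgroup ⧸ (borelAdelic F E c 2).subgroupOf (quasiSplit F E c 2).quotientSubgroup,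
        ‖φ (x * (u : (quasiSplit F E c 2).Adelic)⁻¹ * ((q.out : (quasiSplit F E c 2).quotientSubgroup) : (quasiSplit F E c 2).Adelic))‖ₑ) ∂νN < ∞) :
    Integrable (fun v : ↥(adelicUnipotent F E c 2) => φ (x * (v : (quasiSplit F E c 2).Adelic) *
      ((quasiSplit F E c 2).toAdelic (weylLongU (c : E →+* E) (rfl : (StdForm.antidiagonal 2).over E = (StdForm.antidiagonal 2).over E)))⁻¹)) νN := by
  haveI : DiscreteTopology (quasiSplit F E c 2).quotientSubgroup := by rw [quotientSubgroup_quasiSplit]; exact isDiscreteRational_quasiSplit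
  haveI := secondCountableTopology_adeleRing E
  haveI : SecondCountableTopology (quasiSplit F E c 2).Adelic := inferInstanceAs (SecondCountableTopology (adelic F E c 2 ((StdForm.antidiagonal 2).over E)))
  have hΓN : ((quasiSplit F E c 2).quotientSubgroup).subgroupOf (adelicUnipotent F E c 2) = rationalUnipotent F E c 2 := by
    rw [quotientSubgroup_quasiSplit]; rfl
  have h𝓕' : IsFundamentalDomain ↥(((quasiSplit F E c 2).quotientSubgroup).subgroupOf (adelicUnipotent F E c 2)) 𝓕 νN := by rw [hΓN]; exact h𝓕
  obtain ⟨hex, hdisj, huniq⟩ := bruhat_quotientSubgroup_of_rational (F := F) (weylLongU (c : E →+* E) rfl)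
    (mem_borelU_or_exists_eq_mul_weylLongU_mul_two (c : E →+* E) rfl) (fun _ _ hb hn => mul_weylLongU_mul_not_mem_borelU_two (c : E →+* E) rfl hb hn)
    (fun _ _ _ _ hb hb' hn hn' h => eq_of_mul_weylLongU_mul_eq_two (c : E →+* E) rfl hb hb' hn hn' h)
  obtain ⟨e, he₁, he₂⟩ := exists_equiv_option_quotient_borel hex hdisj huniq
  exact integrable_translate_weyl ((quasiSplit F E c 2).quotientSubgroup) (adelicUnipotent F E c 2) νN hφm hφN hφB e he₁ he₂ h𝓕' x hfin

/-- **TORUS EQUIVARIANCE OF `M(w₀)` ON `U(J₂)(𝔸_F)` WITH `δ_B`**: for `t = diag(d) ∈ T(𝔸_F)` and `φ` with `φ(y · ι(J₂) t ι(J₂)⁻¹) = ξ φ(y)`,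
`M(w₀)φ (x t) = δ_B(t⁻¹) · ξ · M(w₀)φ (x)`, `δ_B(t⁻¹) = torusRootModulus E 2 d⁻¹` (★ `map_torusConj_eq_torusRootModulus_smul_two` at `t⁻¹`).  In `borelHeight`-exponent currency this is «`M(w₀)` sends the exponent
`z` to `2ρ_H − z` and `χ` to `w₀χ`» (corollary to be typed against ★ `K2E1BorelEisensteinUDefs`). [cite: Rogawski1990, §2.2] [cite: Garrett2018, §2.8] -/
theorem intertwiningU_mul_torus_quasiSplit_two (hc : c * c = 1) (hc1 : c ≠ 1) [MeasurableSpace (quasiSplit F E c 2).Adelic] [BorelSpace (quasiSplit F E c 2).Adelic]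
    (νN : Measure ↥(adelicUnipotent F E c 2)) [νN.IsHaarMeasure] {φ : (quasiSplit F E c 2).Adelic → ℂ} (hφm : Measurable φ)
    (t : ↥(torusInBorel F E c 2)) {d : Fin 2 → (AdeleRing (𝓞 E) E)ˣ}
    (hd : glDiagonal 2 (AdeleRing (𝓞 E) E) d = adelicVal F E c 2 _ ((t : borelAdelic F E c 2) : (quasiSplit F E c 2).Adelic)) {ξ : ℂ}
    (hφt : ∀ y : (quasiSplit F E c 2).Adelic, φ (y * ((quasiSplit F E c 2).toAdelic (weylLongU (c : E →+* E) (rfl : (StdForm.antidiagonal 2).over E = (StdForm.antidiagonal 2).over E)) *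
      ((t : borelAdelic F E c 2) : (quasiSplit F E c 2).Adelic) * ((quasiSplit F E c 2).toAdelic (weylLongU (c : E →+* E) rfl))⁻¹)) = ξ * φ y)
    (x : (quasiSplit F E c 2).Adelic) :
    intertwiningU (adelicUnipotent F E c 2) νN ((quasiSplit F E c 2).toAdelic (weylLongU (c : E →+* E) (rfl : (StdForm.antidiagonal 2).over E = (StdForm.antidiagonal 2).over E))) φ
        (x * ((t : borelAdelic F E c 2) : (quasiSplit F E c 2).Adelic)) =
      ((torusRootModulus E 2 d⁻¹ : ℝ) : ℂ) * ξ *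
        intertwiningU (adelicUnipotent F E c 2) νN ((quasiSplit F E c 2).toAdelic (weylLongU (c : E →+* E) (rfl : (StdForm.antidiagonal 2).over E = (StdForm.antidiagonal 2).over E))) φ x := by
  haveI := locallyCompactSpace_adeleRing' E
  haveI := secondCountableTopology_adeleRing E
  letI : MeasurableSpace (AdeleRing (𝓞 E) E) := borel _
  haveI : BorelSpace (AdeleRing (𝓞 E) E) := ⟨rfl⟩
  haveI : SecondCountableTopology (quasiSplit F E c 2).Adelic := inferInstanceAs (SecondCountableTopology (adelic F E c 2 ((StdForm.antidiagonal 2).over E)))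
  have htN : ∀ v : ↥(adelicUnipotent F E c 2), ((t : borelAdelic F E c 2) : (quasiSplit F E c 2).Adelic) * (v : (quasiSplit F E c 2).Adelic) *
      (((t : borelAdelic F E c 2) : (quasiSplit F E c 2).Adelic))⁻¹ ∈ adelicUnipotent F E c 2 := fun v => by
    simpa only [inv_inv] using conj_mem_adelicUnipotent (Subgroup.inv_mem _ (t : borelAdelic F E c 2).2) v.2
  have hd' : glDiagonal 2 (AdeleRing (𝓞 E) E) d⁻¹ = adelicVal F E c 2 _ (((t⁻¹ : ↥(torusInBorel F E c 2)) : borelAdelic F E c 2) : (quasiSplit F E c 2).Adelic) := by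
    rw [map_inv, hd, ← map_inv]; rfl
  have hmod := map_torusConj_eq_torusRootModulus_smul_two (F := F) hc hc1 νN t⁻¹ hd'
  have hfun : (fun v : ↥(adelicUnipotent F E c 2) => (⟨((t : borelAdelic F E c 2) : (quasiSplit F E c 2).Adelic) * (v : (quasiSplit F E c 2).Adelic) *
      (((t : borelAdelic F E c 2) : (quasiSplit F E c 2).Adelic))⁻¹, htN v⟩ : ↥(adelicUnipotent F E c 2))) =
      fun u : ↥(adelicUnipotent F E c 2) => (⟨((((t⁻¹ : ↥(torusInBorel F E c 2)) : borelAdelic F E c 2) : (quasiSplit F E c 2).Adelic))⁻¹ *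
        (u : (quasiSplit F E c 2).Adelic) * (((t⁻¹ : ↥(torusInBorel F E c 2)) : borelAdelic F E c 2) : (quasiSplit F E c 2).Adelic),
          conj_mem_adelicUnipotent ((t⁻¹ : ↥(torusInBorel F E c 2)) : borelAdelic F E c 2).2 u.2⟩ : ↥(adelicUnipotent F E c 2)) := by
    funext v; apply Subtype.ext
    change ((t : borelAdelic F E c 2) : (quasiSplit F E c 2).Adelic) * (v : (quasiSplit F E c 2).Adelic) * (((t : borelAdelic F E c 2) : (quasiSplit F E c 2).Adelic))⁻¹ =
      ((((t : borelAdelic F E c 2) : (quasiSplit F E c 2).Adelic))⁻¹)⁻¹ * (v : (quasiSplit F E c 2).Adelic) * (((t : borelAdelic F E c 2) : (quasiSplit F E c 2).Adelic))⁻¹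
    rw [inv_inv]
  rw [← hfun] at hmod
  rw [intertwiningU_mul_eq_mul (adelicUnipotent F E c 2) νN hφm htN hmod hφt x, ENNReal.coe_toReal]

/-- **«`E_B(φ) = φ + M(w₀)φ`» ON `U(J₃)(𝔸_F)` THROUGH `intertwiningU`** (★ p857329 `…_quasiSplit_three` verbatim, `w₀ = ι(J₃)`): under `∫⁻_𝓕 E_{‖φ‖} < ∞`,
`∫_{u∈𝓕} E_φ(x u⁻¹) dν = (ν 𝓕).toReal • φ(x) + intertwiningU N(𝔸) ν ι(J₃) φ x`. [cite: MoeglinWaldspurger1995, II.1.7] -/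
theorem setIntegral_tsum_borelQuotient_eq_intertwiningU_quasiSplit_three [MeasurableSpace (quasiSplit F E c 3).Adelic] [BorelSpace (quasiSplit F E c 3).Adelic]
    (νN : Measure ↥(adelicUnipotent F E c 3)) [νN.IsMulLeftInvariant] [νN.IsInvInvariant]
    {φ : (quasiSplit F E c 3).Adelic → ℂ} (hφm : Measurable φ) (hφN : ∀ (g : (quasiSplit F E c 3).Adelic) (n : ↥(adelicUnipotent F E c 3)), φ (g * n) = φ g)
    (hφB : ∀ (g : (quasiSplit F E c 3).Adelic) (b : (quasiSplit F E c 3).quotientSubgroup),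
      b ∈ (borelAdelic F E c 3).subgroupOf (quasiSplit F E c 3).quotientSubgroup → φ (g * (b : (quasiSplit F E c 3).Adelic)) = φ g)
    {𝓕 : Set ↥(adelicUnipotent F E c 3)} (h𝓕 : IsFundamentalDomain ↥(rationalUnipotent F E c 3) 𝓕 νN) (x : (quasiSplit F E c 3).Adelic)
    (hfin : ∫⁻ u in 𝓕, (∑' q : (quasiSplit F E c 3).quotientSubgroup ⧸ (borelAdelic F E c 3).subgroupOf (quasiSplit F E c 3).quotientSubgroup,
        ‖φ (x * (u : (quasiSplit F E c 3).Adelic)⁻¹ * ((q.out : (quasiSplit F E c 3).quotientSubgroup) : (quasiSplit F E c 3).Adelic))‖ₑ) ∂νN < ∞) :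
    ∫ u in 𝓕, (∑' q : (quasiSplit F E c 3).quotientSubgroup ⧸ (borelAdelic F E c 3).subgroupOf (quasiSplit F E c 3).quotientSubgroup,
        φ (x * (u : (quasiSplit F E c 3).Adelic)⁻¹ * ((q.out : (quasiSplit F E c 3).quotientSubgroup) : (quasiSplit F E c 3).Adelic))) ∂νN =
      (νN 𝓕).toReal • φ x + intertwiningU (adelicUnipotent F E c 3) νN
        ((quasiSplit F E c 3).toAdelic (weylLongU (c : E →+* E) (rfl : (StdForm.antidiagonal 3).over E = (StdForm.antidiagonal 3).over E))) φ x :=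
  setIntegral_tsum_borelQuotient_eq_quasiSplit_three νN hφm hφN hφB h𝓕 x hfin

/-- **ABSOLUTE CONVERGENCE OF `M(w₀)φ` ON `U(J₃)` FOR FREE**: `∫⁻_{u∈𝓕} E_{‖φ‖}(x u⁻¹) dν < ∞` (what Godement's majorant delivers) makes `v ↦ φ(x v ι(J₃)⁻¹)` integrable on
`N(𝔸_F)` (★ `integrable_translate_weyl` through ★ `bruhat_quotientSubgroup_of_rational`). [cite: MoeglinWaldspurger1995, II.1.6] -/
theorem integrable_intertwiningU_integrand_quasiSplit_three [MeasurableSpace (quasiSplit F E c 3).Adelic] [BorelSpace (quasiSplit F E c 3).Adelic]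
    (νN : Measure ↥(adelicUnipotent F E c 3)) [νN.IsMulLeftInvariant] [νN.IsInvInvariant]
    {φ : (quasiSplit F E c 3).Adelic → ℂ} (hφm : Measurable φ) (hφN : ∀ (g : (quasiSplit F E c 3).Adelic) (n : ↥(adelicUnipotent F E c 3)), φ (g * n) = φ g)
    (hφB : ∀ (g : (quasiSplit F E c 3).Adelic) (b : (quasiSplit F E c 3).quotientSubgroup),
      b ∈ (borelAdelic F E c 3).subgroupOf (quasiSplit F E c 3).quotientSubgroup → φ (g * (b : (quasiSplit F E c 3).Adelic)) = φ g)
    {𝓕 : Set ↥(adelicUnipotent F E c 3)} (h𝓕 : IsFundamentalDomain ↥(rationalUnipotent F E c 3) 𝓕 νN) (x : (quasiSplit F E c 3).Adelic)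
    (hfin : ∫⁻ u in 𝓕, (∑' q : (quasiSplit F E c 3).quotientSubgroup ⧸ (borelAdelic F E c 3).subgroupOf (quasiSplit F E c 3).quotientSubgroup,
        ‖φ (x * (u : (quasiSplit F E c 3).Adelic)⁻¹ * ((q.out : (quasiSplit F E c 3).quotientSubgroup) : (quasiSplit F E c 3).Adelic))‖ₑ) ∂νN < ∞) :
    Integrable (fun v : ↥(adelicUnipotent F E c 3) => φ (x * (v : (quasiSplit F E c 3).Adelic) *
      ((quasiSplit F E c 3).toAdelic (weylLongU (c : E →+* E) (rfl : (StdForm.antidiagonal 3).over E = (StdForm.antidiagonal 3).over E)))⁻¹)) νN := by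
  haveI : DiscreteTopology (quasiSplit F E c 3).quotientSubgroup := by rw [quotientSubgroup_quasiSplit]; exact isDiscreteRational_quasiSplit
  haveI := secondCountableTopology_adeleRing E
  haveI : SecondCountableTopology (quasiSplit F E c 3).Adelic := inferInstanceAs (SecondCountableTopology (adelic F E c 3 ((StdForm.antidiagonal 3).over E)))
  have hΓN : ((quasiSplit F E c 3).quotientSubgroup).subgroupOf (adelicUnipotent F E c 3) = rationalUnipotent F E c 3 := by
    rw [quotientSubgroup_quasiSplit]; rfl
  have h𝓕' : IsFundamentalDomain ↥(((quasiSplit F E c 3).quotientSubgroup).subgroupOf (adelicUnipotent F E c 3)) 𝓕 νN := by rw [hΓN]; exact h𝓕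
  obtain ⟨hex, hdisj, huniq⟩ := bruhat_quotientSubgroup_of_rational (F := F) (weylLongU (c : E →+* E) rfl)
    (mem_borelU_or_exists_eq_mul_weylLongU_mul (c : E →+* E) rfl) (fun _ _ hb hn => mul_weylLongU_mul_not_mem_borelU (c : E →+* E) rfl hb hn)
    (fun _ _ _ _ hb hb' hn hn' h => eq_of_mul_weylLongU_mul_eq (c : E →+* E) rfl hb hb' hn hn' h)
  obtain ⟨e, he₁, he₂⟩ := exists_equiv_option_quotient_borel hex hdisj huniq
  exact integrable_translate_weyl ((quasiSplit F E c 3).quotientSubgroup) (adelicUnipotent F E c 3) νN hφm hφN hφB e he₁ he₂ h𝓕' x hfin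

/-- **TORUS EQUIVARIANCE OF `M(w₀)` ON `U(J₃)(𝔸_F)` WITH `δ_B`**: for `t = diag(d) ∈ T(𝔸_F)` and `φ` with `φ(y · ι(J₃) t ι(J₃)⁻¹) = ξ φ(y)`,
`M(w₀)φ (x t) = δ_B(t⁻¹) · ξ · M(w₀)φ (x)`, `δ_B(t⁻¹) = torusRootModulus E 3 d⁻¹` (★ `map_torusConj_eq_torusRootModulus_smul` at `t⁻¹`).  In `borelHeight`-exponent currency this is «`M(w₀)` sends the exponent
`z` to `2ρ_H − z` and `χ` to `w₀χ`» (corollary to be typed against ★ `K2E1BorelEisensteinUDefs`). [cite: Rogawski1990, §2.2] [cite: Garrett2018, §2.8] -/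
theorem intertwiningU_mul_torus_quasiSplit_three (hc : c * c = 1) (hc1 : c ≠ 1) [MeasurableSpace (quasiSplit F E c 3).Adelic] [BorelSpace (quasiSplit F E c 3).Adelic]
    (νN : Measure ↥(adelicUnipotent F E c 3)) [νN.IsHaarMeasure] {φ : (quasiSplit F E c 3).Adelic → ℂ} (hφm : Measurable φ)
    (t : ↥(torusInBorel F E c 3)) {d : Fin 3 → (AdeleRing (𝓞 E) E)ˣ}
    (hd : glDiagonal 3 (AdeleRing (𝓞 E) E) d = adelicVal F E c 3 _ ((t : borelAdelic F E c 3) : (quasiSplit F E c 3).Adelic)) {ξ : ℂ}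
    (hφt : ∀ y : (quasiSplit F E c 3).Adelic, φ (y * ((quasiSplit F E c 3).toAdelic (weylLongU (c : E →+* E) (rfl : (StdForm.antidiagonal 3).over E = (StdForm.antidiagonal 3).over E)) *
      ((t : borelAdelic F E c 3) : (quasiSplit F E c 3).Adelic) * ((quasiSplit F E c 3).toAdelic (weylLongU (c : E →+* E) rfl))⁻¹)) = ξ * φ y)
    (x : (quasiSplit F E c 3).Adelic) :
    intertwiningU (adelicUnipotent F E c 3) νN ((quasiSplit F E c 3).toAdelic (weylLongU (c : E →+* E) (rfl : (StdForm.antidiagonal 3).over E = (StdForm.antidiagonal 3).over E))) φ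
        (x * ((t : borelAdelic F E c 3) : (quasiSplit F E c 3).Adelic)) =
      ((torusRootModulus E 3 d⁻¹ : ℝ) : ℂ) * ξ *
        intertwiningU (adelicUnipotent F E c 3) νN ((quasiSplit F E c 3).toAdelic (weylLongU (c : E →+* E) (rfl : (StdForm.antidiagonal 3).over E = (StdForm.antidiagonal 3).over E))) φ x := by
  haveI := locallyCompactSpace_adeleRing' E
  haveI := secondCountableTopology_adeleRing E
  letI : MeasurableSpace (AdeleRing (𝓞 E) E) := borel _
  haveI : BorelSpace (AdeleRing (𝓞 E) E) := ⟨rfl⟩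
  haveI : SecondCountableTopology (quasiSplit F E c 3).Adelic := inferInstanceAs (SecondCountableTopology (adelic F E c 3 ((StdForm.antidiagonal 3).over E)))
  have htN : ∀ v : ↥(adelicUnipotent F E c 3), ((t : borelAdelic F E c 3) : (quasiSplit F E c 3).Adelic) * (v : (quasiSplit F E c 3).Adelic) *
      (((t : borelAdelic F E c 3) : (quasiSplit F E c 3).Adelic))⁻¹ ∈ adelicUnipotent F E c 3 := fun v => by
    simpa only [inv_inv] using conj_mem_adelicUnipotent (Subgroup.inv_mem _ (t : borelAdelic F E c 3).2) v.2
  have hd' : glDiagonal 3 (AdeleRing (𝓞 E) E) d⁻¹ = adelicVal F E c 3 _ (((t⁻¹ : ↥(torusInBorel F E c 3)) : borelAdelic F E c 3) : (quasiSplit F E c 3).Adelic) := by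
    rw [map_inv, hd, ← map_inv]; rfl
  have hmod := map_torusConj_eq_torusRootModulus_smul (F := F) hc hc1 νN t⁻¹ hd'
  have hfun : (fun v : ↥(adelicUnipotent F E c 3) => (⟨((t : borelAdelic F E c 3) : (quasiSplit F E c 3).Adelic) * (v : (quasiSplit F E c 3).Adelic) *
      (((t : borelAdelic F E c 3) : (quasiSplit F E c 3).Adelic))⁻¹, htN v⟩ : ↥(adelicUnipotent F E c 3))) =
      fun u : ↥(adelicUnipotent F E c 3) => (⟨((((t⁻¹ : ↥(torusInBorel F E c 3)) : borelAdelic F E c 3) : (quasiSplit F E c 3).Adelic))⁻¹ *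
        (u : (quasiSplit F E c 3).Adelic) * (((t⁻¹ : ↥(torusInBorel F E c 3)) : borelAdelic F E c 3) : (quasiSplit F E c 3).Adelic),
          conj_mem_adelicUnipotent ((t⁻¹ : ↥(torusInBorel F E c 3)) : borelAdelic F E c 3).2 u.2⟩ : ↥(adelicUnipotent F E c 3)) := by
    funext v; apply Subtype.ext
    change ((t : borelAdelic F E c 3) : (quasiSplit F E c 3).Adelic) * (v : (quasiSplit F E c 3).Adelic) * (((t : borelAdelic F E c 3) : (quasiSplit F E c 3).Adelic))⁻¹ =
      ((((t : borelAdelic F E c 3) : (quasiSplit F E c 3).Adelic))⁻¹)⁻¹ * (v : (quasiSplit F E c 3).Adelic) * (((t : borelAdelic F E c 3) : (quasiSplit F E c 3).Adelic))⁻¹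
    rw [inv_inv]
  rw [← hfun] at hmod
  rw [intertwiningU_mul_eq_mul (adelicUnipotent F E c 3) νN hφm htN hmod hφt x, ENNReal.coe_toReal]

end Mok

end Summit.HodgeConjecture.HodgeConjecture.Cruxes.H413.K2E1EisensteinIntertwiningU

end
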